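import Summits.HodgeConjecture.HodgeConjecture.Theorems.F0P3SpectralPacketTransport   -- ★ (N) FILE 3f p842582 (this seat): `evpGψ`, `trSψ`, `transportAPackets` (+ ★ 3d `tr`; ★ 3a `SpectralPacketG`; ★ 2∕2b `GlobalPacket(H)`, `ramFinset`, `evpAt`; ★ 1b `ArchPacketKit`; ★ 1 `LocalPacketKit`)
import HarnessLib

/-!
# (N) DEFS, FILE 3g — THE `H`-SIDE OF THE SPECTRAL TUPLE, I: the posited ARCHIMEDEAN∕ENDOSCOPIC packet datum `ArchPacketKitH 𝔞` of `H_∞` (twin of ★ FILE 1b), its two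
# archimedean traces `trPktInfH` (on `H_∞`-data) and `endoTrPktInf` (read on `G′_∞`-data through `ξ_H`), and the DISCRETE `H`-PACKET carrier `SpectralPacketH` (twin of ★ FILE 3a)
# with its slots `imageG` (`Π(ρ) = ξ_H(ρ)`), `ramFinsetH` (`ramH`) — Rogawski §13.3 pp. 202–203 (Thms. 13.3.4, 13.3.7, 13.3.8), §13.1 Thm. 13.1.1 p. 198, §12.1–12.3

Cell `hodgecm-mathlib` (D-0151), F0∕P3 «U3-mult», crux H413 (`stmt-HodgeConjecture-24833`), route of record `HCCMUnconditional`.  (N) lead pen F0P3a-p01 (g12); census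
`F0/P3a/F0P3a-p01/g12/CENSUS-N-FILE3-WIRING.F0P3a-p01g12.md` 9c106a7a §W1 rows #2 #6 #8 #10 #14, §W2 FILE 3g; LEAD F0P3a-plan (g10).  Definition lane (TWO structures of
posited DATA + five data `def`s with explicit binders) + `rfl`∕one-line read-backs; namespaces `…F0P3ArchPacketKit` (★ FILE 1b's) and `…F0P3SpectralPacket` (★ FILE 3a's);
box-before-file (B-typ03); `--supports stmt-HodgeConjecture-24833 --as helper`.  No instance, no notation, no named fact, no `sorry`.  ASSERTS NOTHING: like ★ FILE 1∕1b the
`H_∞`-datum is POSITED (its laws — the archimedean character identities Prop. 12.3.3, (ℓ8)∞ — are typed by their consumers); `DiscH` («`ρ` is a discrete automorphic packet of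
`H`», the `H`-side automorphic measure of census q2) and the `H_∞`-characters `archTrH` are PARAMETERS.
HONEST LABEL: HC_CM is proved only modulo the printed citations until rung 0 closes; this file proves no printed statement — it names the carriers the tuple's `PH`, `nH`, `trH`,
`evpH`, `ramH`, `trHS` slots are typed over (census §W1).

PRINT.  `H = U(2) × U(1)` (quasi-split, `E/F`); its L-packets `Π(H)` [§12.1, §13.1 Thm. 13.1.1]; the endoscopic transfer `ρ ↦ ξ_H(ρ) = Π(ρ)` with pairings `⟨ρ, π⟩` [Thm. 13.1.1 (2),
p. 199; at `∞`: §12.3 Prop. 12.3.3]; global packets `ρ = ⊗ ρ_v` of `H`, discrete ones `Π(H)` [§13.3 p. 202], `Π̂ = {ρ ∈ Π(H) : Π = Π(ρ)}` [p. 203], `n(ρ)` [Thm. 13.3.8 / (14.6.1)];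
the `H`-side traces `Tr ρ(f^H) = ∏_v Tr ρ_v(f^H_v)` (L-packets of `H`: all coefficients `1`) and their endoscopic reading `Σ_{π ∈ Π(ρ_v)} ⟨ρ_v, π⟩ Tr π(f_v)` [Thm. 13.1.1 (2)].

CONTENTS.
* §1 (g1) **`structure ArchPacketKitH (𝔞 : ArchPacketKit)`** — posited `H_∞`-datum in the style of ★ FILE 1b: `CinfH` (archimedean class tokens of `H_∞ = U(1,1) × U(1)`; the tree has
  no `(𝔥, K_H)`-class type, so the tokens are abstract), `PktInfH`, `memInfH : PktInfH → Finset CinfH`, `xiHInf : PktInfH → 𝔞.PktInf` (`ξ_H` at `∞`), `pairInf : PktInfH → Cinf → ℤ`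
  (`⟨ρ_∞, ·⟩`, junk `0` off `memInf (xiHInf ρ_∞)`).  (g2) `trPktInfH 𝔞H archTrH P f := Σ_{c ∈ memInfH P} archTrH c f` (`Tr ρ_∞(f^H_∞)`; `archTrH` a parameter);
  (g3) `endoTrPktInf 𝔞H archTr P f := Σ_{c ∈ 𝔞.memInf (xiHInf P)} pairInf P c · archTr c f` (the endoscopic reading on `G′_∞`∕`G_∞`-data — the archimedean factor of the slot `trHS`);
  `IsCharPacketInf 𝔞H P c := memInfH P = {c}` («`ρ_∞` is the singleton packet of the class `c`» — for `ρXi`'s archimedean slot, (ℓ8)∞ shape); `rfl` unfoldings.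
* §2 (g4) **`structure SpectralPacketH 𝔩 𝔞 𝔞H DiscH`** — a DISCRETE GLOBAL PACKET OF `H` WITH ITS ARCHIMEDEAN COMPONENT: `fin : GlobalPacketH 𝔩`, `inf : 𝔞H.PktInfH`,
  `cofinite_unrH : ∀ᶠ v, (𝔩 v).unr ((𝔩 v).xiH (fin.loc v))` («`ρ_v` unramified a.e.», read through `ξ_H` — ★ `GlobalPacketH` carries no such clause), `isDiscrete : DiscH fin inf` (the
  PARAMETER predicate «`ρ ∈ Π(H)` discrete», census q2) — the tuple's `PH`.  (g5) `SpectralPacketH.imageG ρ : GlobalPacket 𝔩 := ⟨ξ_H ∘ ρ.fin.loc, ρ.cofinite_unrH⟩` (`Π(ρ)`, p. 199) with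
  `imageG_isImageOf : (imageG ρ).IsImageOf ρ.fin` (★ FILE 2 `IsImageOf`); (g6) `ramFinsetH ρ := (imageG ρ).ramFinset` (the slot `ramH`, ★ FILE 2b) + `mem_ramFinsetH_iff`;
  (g7) `trFinAt ρ v νH fH := (𝔩 v).trPktH νH (ρ.fin.loc v) fH` (the finite local factor of `Tr ρ(f^H)`) + `rfl`.
* NOT here (FILE 3h): `trH` total on `TestH L` (★ `PureTensor₂` presentations, twin of ★ FILE 3d), `trHS` on `TestS₀` (= `endoTrPktInf` × the (ℓ2)-shaped finite endoscopic sums through `ψ`),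
  `evpH` (= ★ FILE 3f `evpGψ`-reading of `imageG ρ`), `nH` (parameter + law).

References: [Rogawski1990] §13.3 pp. 202–203 (Thms. 13.3.4, 13.3.7, 13.3.8), §13.1 Thm. 13.1.1 p. 198, p. 199, §12.1 p. 171, §12.3 Prop. 12.3.3 p. 178, §14.6 (14.6.1) p. 241.
-/

set_option autoImplicit false
-- the mandated namespace repeats `HodgeConjecture.HodgeConjecture`, as in every `Theorems/*.lean` of this sub-problem
set_option linter.dupNamespace false

noncomputable section

open NumberField IsDedekindDomain MeasureTheory Filter
open scoped Matrix MatrixGroups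

open Literature.NumberTheory Literature.NumberTheory.Automorphic Literature.NumberTheory.Automorphic.UnitaryGroup
open Literature.NumberTheory.Rogawski1990 Literature.NumberTheory.GaloisRepresentations
open Literature.RepresentationTheory.BorelWallach2000 Literature.RepresentationTheory.KonnoKonno2007
open Summit.HodgeConjecture.HodgeConjecture.Cruxes.H413.F0P3LocalPacketKit

/-! ## §1 The posited archimedean∕endoscopic packet datum of `H_∞` [§12.1; §12.3 Prop. 12.3.3; Thm. 13.1.1 (2)] -/

namespace Summit.HodgeConjecture.HodgeConjecture.Cruxes.H413.F0P3ArchPacketKit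

/-- **(g1) `ArchPacketKitH 𝔞` — POSITED PACKET DATA OF `H_∞ = U(1,1) × U(1)` AT THE REAL PLACE, RELATIVE TO the `G`-side datum `𝔞`** (twin of ★ `ArchPacketKit`): archimedean
class tokens `CinfH` (abstract: the tree has no `(𝔥, K_H)`-class type), packets `PktInfH` with finite member sets `memInfH` (L-packets of `H_∞`: all coefficients `1`), the
endoscopic transfer `xiHInf : Π(H_∞) → Π(G_∞)` and the pairings `pairInf ρ_∞ = ⟨ρ_∞, ·⟩` on `memInf (xiHInf ρ_∞)` (junk `0` elsewhere).  DATA ONLY; no law is asserted here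
(the character identities of Prop. 12.3.3 are the consumers' named hypotheses). [cite: Rogawski1990, §12.1 p. 171; §12.3 Prop. 12.3.3 p. 178; §13.1 Thm. 13.1.1 p. 198] -/
structure ArchPacketKitH (𝔞 : ArchPacketKit) : Type 1 where
  /-- the archimedean classes of `H_∞` (token type). -/
  CinfH : Type
  /-- the archimedean packets `Π(H_∞)` (index type). -/
  PktInfH : Type
  /-- the members of an `H_∞`-packet (a finite set of tokens). -/
  memInfH : PktInfH → Finset CinfH
  /-- the endoscopic transfer `ξ_H : Π(H_∞) → Π(G_∞)`. -/
  xiHInf : PktInfH → 𝔞.PktInf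
  /-- `⟨ρ_∞, c⟩` for `c ∈ 𝔞.memInf (xiHInf ρ_∞)` (junk `0` elsewhere). -/
  pairInf : PktInfH → GKIrrClass (uFormGroup (Fin 2) (Fin 1)) → ℤ

namespace ArchPacketKitH

variable {𝔞 : ArchPacketKit}

/-- **(g2) `Tr ρ_∞(f^H_∞) := Σ_{c ∈ ρ_∞} Θ_c(f^H_∞)`** for given archimedean `H_∞`-characters `archTrH` (a parameter; L-packets of `H_∞` carry coefficient `1` on every member).
[cite: Rogawski1990, §12.1 p. 171; §13.3 p. 203] -/
def trPktInfH (𝔞H : ArchPacketKitH 𝔞) {X : Type} (archTrH : 𝔞H.CinfH → (X → ℂ) → ℂ) (P : 𝔞H.PktInfH) (f : X → ℂ) : ℂ :=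
  ∑ c ∈ 𝔞H.memInfH P, archTrH c f

/-- **(g3) THE ENDOSCOPIC READING `Σ_{π ∈ Π(ρ_∞)} ⟨ρ_∞, π⟩ · Θ_π(f_∞)`** of `Tr ρ_∞(f^H_∞)` on `G′_∞`∕`G_∞`-data, for given `G`-side archimedean characters `archTr` (the closer's
★ `archTr₀`) — the archimedean factor of the slot `trHS` (character identity Prop. 12.3.3: equal to `Tr ρ_∞(f^H_∞)` for matched `(f_∞, f^H_∞)`; typed by the consumer).
[cite: Rogawski1990, §12.3 Prop. 12.3.3 p. 178; §13.1 Thm. 13.1.1 p. 198] -/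
def endoTrPktInf (𝔞H : ArchPacketKitH 𝔞) {X : Type} (archTr : GKIrrClass (uFormGroup (Fin 2) (Fin 1)) → (X → ℂ) → ℂ) (P : 𝔞H.PktInfH) (f : X → ℂ) : ℂ :=
  ∑ c ∈ 𝔞.memInf (𝔞H.xiHInf P), (𝔞H.pairInf P c : ℂ) * archTr c f

/-- **`IsCharPacketInf 𝔞H P c` — «`ρ_∞` IS THE SINGLETON PACKET OF THE CLASS `c`»** (one-dimensional `ξ_∞` as an `H_∞`-packet, §12.1 type (3); the archimedean slot of the
tuple's `ρXi ξ`). [cite: Rogawski1990, §12.1 p. 171; §13.1 p. 199] -/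
def IsCharPacketInf (𝔞H : ArchPacketKitH 𝔞) (P : 𝔞H.PktInfH) (c : 𝔞H.CinfH) : Prop :=
  𝔞H.memInfH P = {c}

/-- `trPktInfH` unfolds to the member sum. [cite: Rogawski1990, §12.1 p. 171] -/
theorem trPktInfH_eq (𝔞H : ArchPacketKitH 𝔞) {X : Type} (archTrH : 𝔞H.CinfH → (X → ℂ) → ℂ) (P : 𝔞H.PktInfH) (f : X → ℂ) :
    𝔞H.trPktInfH archTrH P f = ∑ c ∈ 𝔞H.memInfH P, archTrH c f :=
  rfl

/-- `endoTrPktInf` unfolds to the paired sum over `Π(ρ_∞) = ξ_H(ρ_∞)`. [cite: Rogawski1990, §12.3 Prop. 12.3.3 p. 178] -/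
theorem endoTrPktInf_eq (𝔞H : ArchPacketKitH 𝔞) {X : Type} (archTr : GKIrrClass (uFormGroup (Fin 2) (Fin 1)) → (X → ℂ) → ℂ) (P : 𝔞H.PktInfH) (f : X → ℂ) :
    𝔞H.endoTrPktInf archTr P f = ∑ c ∈ 𝔞.memInf (𝔞H.xiHInf P), (𝔞H.pairInf P c : ℂ) * archTr c f :=
  rfl

/-- On a singleton packet the `H_∞`-trace is the one member's character. [cite: Rogawski1990, §12.1 p. 171] -/
theorem trPktInfH_of_isCharPacketInf (𝔞H : ArchPacketKitH 𝔞) {X : Type} (archTrH : 𝔞H.CinfH → (X → ℂ) → ℂ) {P : 𝔞H.PktInfH} {c : 𝔞H.CinfH}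
    (h : 𝔞H.IsCharPacketInf P c) (f : X → ℂ) : 𝔞H.trPktInfH archTrH P f = archTrH c f := by
  rw [trPktInfH_eq, h, Finset.sum_singleton]

end ArchPacketKitH

end Summit.HodgeConjecture.HodgeConjecture.Cruxes.H413.F0P3ArchPacketKit

/-! ## §2 The discrete `H`-packet with its archimedean component [§13.3 pp. 202–203] -/

namespace Summit.HodgeConjecture.HodgeConjecture.Cruxes.H413.F0P3SpectralPacket

open Summit.HodgeConjecture.HodgeConjecture.Cruxes.H413.F0P3GlobalPacket
open Summit.HodgeConjecture.HodgeConjecture.Cruxes.H413.F0P3ArchPacketKit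

variable {L : Type} [Field L] [NumberField L] [IsCMField L] {H' : Matrix (Fin 3) (Fin 3) L}

/-- **(g4) `SpectralPacketH 𝔩 𝔞 𝔞H DiscH` — A DISCRETE GLOBAL PACKET OF `H` WITH ITS ARCHIMEDEAN COMPONENT** (twin of ★ FILE 3a `SpectralPacketG`): `fin` the finite-place
packet family `(ρ_v)_v` (★ FILE 2 `GlobalPacketH`), `inf` an archimedean packet of the datum `𝔞H`, `cofinite_unrH` («`Π(ρ_v) = ξ_H(ρ_v)` is unramified for almost all `v`» — the
clause ★ `GlobalPacketH` does not carry), and `isDiscrete : DiscH fin inf` for the PARAMETER predicate «`ρ` is a discrete automorphic packet of `H`» (census q2: the `H`-side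
automorphic measure is not typed yet).  The tuple's `PH`. [cite: Rogawski1990, §13.3 p. 202, Thm. 13.3.8 p. 203; §13.1 p. 199] -/
structure SpectralPacketH (𝔩 : ∀ v : HeightOneSpectrum (𝓞 ↥(maximalRealSubfield L)), LocalPacketKit L H' v) (𝔞 : ArchPacketKit) (𝔞H : ArchPacketKitH 𝔞)
    (DiscH : GlobalPacketH 𝔩 → 𝔞H.PktInfH → Prop) : Type where
  /-- the finite-place packet family `⊗_{v < ∞} ρ_v`. -/
  fin : GlobalPacketH 𝔩
  /-- the archimedean packet `ρ_∞`. -/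
  inf : 𝔞H.PktInfH
  /-- «`ξ_H(ρ_v)` contains an unramified representation for almost all `v`». -/
  cofinite_unrH : ∀ᶠ v in cofinite, (𝔩 v).unr ((𝔩 v).xiH (fin.loc v))
  /-- «`ρ` is a discrete automorphic packet of `H`» (parameter predicate). -/
  isDiscrete : DiscH fin inf

namespace SpectralPacketH

variable {𝔩 : ∀ v : HeightOneSpectrum (𝓞 ↥(maximalRealSubfield L)), LocalPacketKit L H' v} {𝔞 : ArchPacketKit} {𝔞H : ArchPacketKitH 𝔞}
  {DiscH : GlobalPacketH 𝔩 → 𝔞H.PktInfH → Prop}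

/-- **(g5) `ρ.imageG = Π(ρ) := ξ_H(ρ)`** as a finite-place global packet of `G` (★ FILE 2 `GlobalPacket`; its cofinite-unramified clause is `ρ.cofinite_unrH`).
[cite: Rogawski1990, §13.1 p. 199; §13.3 Thm. 13.3.4 p. 202] -/
def imageG (ρ : SpectralPacketH 𝔩 𝔞 𝔞H DiscH) : GlobalPacket 𝔩 :=
  ⟨fun v => (𝔩 v).xiH (ρ.fin.loc v), ρ.cofinite_unrH⟩

/-- `(imageG ρ).loc v = ξ_H(ρ_v)`. [cite: Rogawski1990, §13.1 p. 199] -/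
theorem imageG_loc (ρ : SpectralPacketH 𝔩 𝔞 𝔞H DiscH) (v : HeightOneSpectrum (𝓞 ↥(maximalRealSubfield L))) :
    ρ.imageG.loc v = (𝔩 v).xiH (ρ.fin.loc v) :=
  rfl

/-- `Π(ρ)` IS the image of `ρ` (★ FILE 2 `IsImageOf`). [cite: Rogawski1990, §13.1 p. 199; §13.3 Thm. 13.3.4 p. 202] -/
theorem imageG_isImageOf (ρ : SpectralPacketH 𝔩 𝔞 𝔞H DiscH) : ρ.imageG.IsImageOf ρ.fin :=
  fun _ => rfl

/-- **(g6) `ρ.ramFinsetH` — the finite set of places where `ξ_H(ρ_v)` contains no unramified representation** (the tuple's `ramH ρ`; ★ FILE 2b `ramFinset` of `Π(ρ)`).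
[cite: Rogawski1990, §13.3 p. 199 ¶2, p. 202] -/
def ramFinsetH (ρ : SpectralPacketH 𝔩 𝔞 𝔞H DiscH) : Finset (HeightOneSpectrum (𝓞 ↥(maximalRealSubfield L))) :=
  ρ.imageG.ramFinset

/-- `v ∈ ρ.ramFinsetH ↔ ξ_H(ρ_v)` is not unramified. [cite: Rogawski1990, §13.3 p. 199 ¶2] -/
theorem mem_ramFinsetH_iff (ρ : SpectralPacketH 𝔩 𝔞 𝔞H DiscH) (v : HeightOneSpectrum (𝓞 ↥(maximalRealSubfield L))) :
    v ∈ ρ.ramFinsetH ↔ ¬ (𝔩 v).unr ((𝔩 v).xiH (ρ.fin.loc v)) :=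
  ρ.imageG.mem_ramFinset_iff v

/-- Off `ρ.ramFinsetH`, `ξ_H(ρ_v)` is unramified. [cite: Rogawski1990, §13.3 p. 199 ¶2] -/
theorem unr_xiH_of_not_mem_ramFinsetH (ρ : SpectralPacketH 𝔩 𝔞 𝔞H DiscH) {v : HeightOneSpectrum (𝓞 ↥(maximalRealSubfield L))}
    (hv : v ∉ ρ.ramFinsetH) : (𝔩 v).unr ((𝔩 v).xiH (ρ.fin.loc v)) :=
  ρ.imageG.unr_of_not_mem_ramFinset hv

/-- **(g7) The finite local factor `Tr ρ_v(f^H_v)`** of `Tr ρ(f^H) = Tr ρ_∞(f^H_∞) · ∏_v Tr ρ_v(f^H_v)` (★ FILE 1 `trPktH` at `ρ.fin.loc v`). [cite: Rogawski1990, §13.1 Thm. 13.1.1 p. 198; §13.3 p. 203] -/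
def trFinAt (ρ : SpectralPacketH 𝔩 𝔞 𝔞H DiscH) (v : HeightOneSpectrum (𝓞 ↥(maximalRealSubfield L)))
    [MeasurableSpace ((UnitaryGroup.cmDatum L 2 (Matrix.of fun i j : Fin 2 => if i.val + j.val + 1 = 2 then (1 : L) else 0)).Local v ×
      (UnitaryGroup.cmDatum L 1 (Matrix.of fun i j : Fin 1 => if i.val + j.val + 1 = 1 then (1 : L) else 0)).Local v)]
    (νH : Measure ((UnitaryGroup.cmDatum L 2 (Matrix.of fun i j : Fin 2 => if i.val + j.val + 1 = 2 then (1 : L) else 0)).Local v ×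
      (UnitaryGroup.cmDatum L 1 (Matrix.of fun i j : Fin 1 => if i.val + j.val + 1 = 1 then (1 : L) else 0)).Local v))
    (fH : (UnitaryGroup.cmDatum L 2 (Matrix.of fun i j : Fin 2 => if i.val + j.val + 1 = 2 then (1 : L) else 0)).Local v ×
      (UnitaryGroup.cmDatum L 1 (Matrix.of fun i j : Fin 1 => if i.val + j.val + 1 = 1 then (1 : L) else 0)).Local v → ℂ) : ℂ :=
  (𝔩 v).trPktH νH (ρ.fin.loc v) fH

/-- Unfolding of `trFinAt`. [cite: Rogawski1990, §13.1 Thm. 13.1.1 p. 198] -/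
theorem trFinAt_eq (ρ : SpectralPacketH 𝔩 𝔞 𝔞H DiscH) (v : HeightOneSpectrum (𝓞 ↥(maximalRealSubfield L)))
    [MeasurableSpace ((UnitaryGroup.cmDatum L 2 (Matrix.of fun i j : Fin 2 => if i.val + j.val + 1 = 2 then (1 : L) else 0)).Local v ×
      (UnitaryGroup.cmDatum L 1 (Matrix.of fun i j : Fin 1 => if i.val + j.val + 1 = 1 then (1 : L) else 0)).Local v)]
    (νH : Measure ((UnitaryGroup.cmDatum L 2 (Matrix.of fun i j : Fin 2 => if i.val + j.val + 1 = 2 then (1 : L) else 0)).Local v ×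
      (UnitaryGroup.cmDatum L 1 (Matrix.of fun i j : Fin 1 => if i.val + j.val + 1 = 1 then (1 : L) else 0)).Local v))
    (fH : (UnitaryGroup.cmDatum L 2 (Matrix.of fun i j : Fin 2 => if i.val + j.val + 1 = 2 then (1 : L) else 0)).Local v ×
      (UnitaryGroup.cmDatum L 1 (Matrix.of fun i j : Fin 1 => if i.val + j.val + 1 = 1 then (1 : L) else 0)).Local v → ℂ) :
    ρ.trFinAt v νH fH = ∑ σ ∈ (𝔩 v).memH (ρ.fin.loc v), σ.smoothTrace νH fH :=
  rfl

/-- The image packet `Π(ρ)` as a `G`-side object has `n`-denominator data: `Π(ρ).IsImageOf ρ.fin` enters ★ FILE 2 `hatCard` (for `n(Π) = Card(Π̂)⁻¹`, Thm. 13.3.7) through the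
finite-part predicate `fun σ => ∃ P∞, DiscH σ P∞`. [cite: Rogawski1990, §13.3 Thm. 13.3.7 pp. 202–203] -/
theorem exists_discH_fin (ρ : SpectralPacketH 𝔩 𝔞 𝔞H DiscH) : ∃ P : 𝔞H.PktInfH, DiscH ρ.fin P :=
  ⟨ρ.inf, ρ.isDiscrete⟩

end SpectralPacketH

end Summit.HodgeConjecture.HodgeConjecture.Cruxes.H413.F0P3SpectralPacket

end
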